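/-
Copyright (c) 2026 the pub-hodgecm-mathlib formalisation cell (harness21).  Prover seat hodgecm-mathlib-LH4-p13 (g2), req620 Track A «(D-RAM) FOUR-FRAME» squad
(heir LEAD F0P3a-plan lineage; dealer LH4-plan lineage; MS ROAD A, Stage B: §P₂ «PERMUTATION TRANSPORT, TYPE 2» — the type-2 twin of ★ p856089 `F0P3cDyRamDiagonalPermutation`, written for a
GENERAL permutation-invariant weight so that it serves the B10₂ head whichever way the UNIQ₂ re-key (dealer WORD #21) goes; the `w`-instances of §3 carry the names and binders of
LH4-p11 (g2)'s parallel cand df7f82c7 — one file for both seats).  2026-09-04.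
-/
import Summits.HodgeConjecture.HodgeConjecture.Theorems.F0P3cDyRamDiagonalPermutation   -- ★ §P p856089 (this seat): permutation matrices, transport of `𝓛₀`, `HasAxis`, weight; G2∕G3 adapters (type 0); brings ★ StrataDefs ED. 2
import HarnessLib

/-!
# Crux `H413`, MS ROAD A, STAGE B — §P₂ «PERMUTATION TRANSPORT FOR THE TYPE-2 STRATA» (`stratumTwo`, general weight)

Cell `hodgecm-mathlib` (D-0151), FLOOR 0, crux item H413 = `stmt-HodgeConjecture-24833`, route of record `HCCMUnconditional`; squad F0∕P3c∕LH4 (req618∕req620).  THEOREMS ONLY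
(no `def`, no instance, no notation, no `sorry`, default heartbeats); lane `--supports stmt-HodgeConjecture-24833 --as helper` (count-neutral).  Road target: tree
`Cruxes/H413/Lines/F0_P3c_DyRamFourFrame_U3_Laws.lean` stub `stub_U3_stableModelSum` (MS), type-2 half.  The B10₂ assembly (LH4-p10 (g2) skeleton `B10-StableCountTypeTwo.SKELETON.v1`
08e5e6e2, probe `…ASSEMBLY-PROBE.v1` 6c94b6e5) obtains the glued type-2 strata with foot on `B₂`, `B₃` — axis vectors `(2ρ+1+s, 2ρ+1, 2ρ+1+s)`, `(2ρ+1+s, 2ρ+1+s, 2ρ+1)` — from the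
`B₁`-footed one by a coordinate permutation, exactly as ★ §P does at type 0 (`finsum_stabiliserWeight_stratum_G2_of_G1 ∕ _G3_of_G1`).  After LH4-p09 (g2)'s UNIQ₂ flag (00:42:58Z;
REF5 R5-75: on glued strata with `ρ` even the type-2 polarisations form `q` cosets, not one) the type-2 head is being RE-KEYED on the multiplicity `n₂(M)` (dealer WORD #21), so THIS FILE
transports `stratumTwo` for an ARBITRARY weight `f` invariant under coordinate permutations (`f (P·M) = f M`): `f := stabiliserWeight σ` (★ `stabiliserWeight_mapGL_perm`) and
`f := n₂ · stabiliserWeight σ` (once `n₂` is named and its invariance proved from §1 here) both instantiate.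

WHAT IS PROVED (any field `K` with a valuation; `P` the permutation matrix of `π`, `P·(x ∘ π) = x`).
* §1 `isVertexLattice_diagonal_mapGL_perm_iff` — at ANY type `tv`: `P·M` is a type-`tv` vertex lattice of `diag(D)` iff `M` is one of `diag(D ∘ π⁻¹)` (★ `isVertexLattice_formCongr_iff`
  + ★ `formCongr_permMatrix_diagonal`) — the polarisation SETS correspond under `D ↦ D ∘ π⁻¹` (the datum the re-keyed `n₂` needs); `isTypeTwoPolarisable_mapGL_perm_iff`;
  `mem_fixedUnitStabilizer_mapGL_perm_iff` (`S_F(P·M) = {u | u ∘ π⁻¹ ∈ S_F(M)}`).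
* §2 `image_mapGL_stratumTwo` — `P · stratumTwo(P⁻¹TP, a ∘ π⁻¹) = stratumTwo(T, a)`; HEAD `finsum_mem_stratumTwo_perm (f) (hf : ∀ M, f (P·M) = f M)`:
  `∑ᶠ_{M ∈ stratumTwo(T,a)} f M = ∑ᶠ_{M ∈ stratumTwo(P⁻¹TP, a ∘ π⁻¹)} f M`; `finsum_stabiliserWeight_stratumTwo_perm` (the `f := w` instance); `stratumTwo_eq_of_coe_eq_smul` (unit rescaling of `T`).
* §3 the B10₂ adapters for a general axis triple and a general invariant weight: `finsum_mem_stratumTwo_swap01_of` (`(a,b,c) ↦ (b,a,c)`, datum `(β,α)`, depths `(n₂,n₁,n₃)`) and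
  `finsum_mem_stratumTwo_swap02_of` (`(a,b,c) ↦ (c,b,a)`, datum `(α⁻¹, βα⁻¹)`, depths `(n₃,n₂,n₁)`); and their `f := w` instances with the names and binders of LH4-p11 (g2)'s parallel cand
  (merged by letter, lit4 (1528)(c)): `finsum_stabiliserWeight_stratumTwo_swap01_of ∕ _swap02_of` (`a₀ a₁ a₂`), `…_T2_of_T1 ∕ _T3_of_T1` (`(0,s,s) ↦ (s,0,s), (s,s,0)`),
  `…_G2_of_G1 ∕ _G3_of_G1` (`(r, r+s, r+s) ↦ (r+s, r, r+s), (r+s, r+s, r)`; `r = 2ρ+1` for the type-2 glued strata).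
HONEST LABEL.  Count-neutral (`--supports`); nothing printed is asserted; (MS) and the census laws stay PROVER TARGETS until the Stage B bricks and B10∕B10₂ land; `HC_CM` is proved only
modulo the 7 printed citations (2 remaining named inputs: hLiu418 = `stmt-HodgeConjecture-24832`, h413 = `stmt-HodgeConjecture-24833`) until rung 0 closes.

## References
* [Kottwitz1986BaseChangeUnits] R. E. Kottwitz, *Base change for unit elements of Hecke algebras*, Compositio Math. 60 (1986), §1 pp. 240–241.
* [Rogawski1990] J. D. Rogawski, *Automorphic Representations of Unitary Groups in Three Variables*, Ann. of Math. Stud. 123 (1990), §4.9 Prop. 4.9.1 (a) p. 55.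
* [Serre1980Trees] J.-P. Serre, *Trees*, Springer (1980), Ch. II §1.1.
-/

set_option autoImplicit false

noncomputable section

namespace Summit.HodgeConjecture.HodgeConjecture.Cruxes.H413.F0P3cDyRamDiagonalPermutationTwo

open Matrix
open Literature.NumberTheory.Automorphic Literature.NumberTheory.Automorphic.HermitianLattice
open Literature.NumberTheory.Automorphic.UnitaryLatticeTree
open Summit.HodgeConjecture.HodgeConjecture.Cruxes.H413.F0P3cDyRamDiagonalTorusDefs
open Summit.HodgeConjecture.HodgeConjecture.Cruxes.H413.F0P3cDyRamDiagonalStrataDefs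
open Summit.HodgeConjecture.HodgeConjecture.Cruxes.H413.F0P3cDyRamDiagonalPermutation
open scoped Valued WithZero Matrix MatrixGroups

variable {K : Type*} [Field K] [Valued K ℤᵐ⁰] {N : ℕ}

/-! ## §1  Transport of polarisations (any type), of type-2 polarisability, and of `S_F` -/

/-- **POLARISATIONS UNDER A COORDINATE PERMUTATION (any type `tv`)**: `P·M` is a type-`tv` vertex lattice of `diag(D)` iff `M` is one of `diag(D ∘ π⁻¹)` — the Gram matrix of
`diag(D)` in the permuted frame is `diag(D ∘ π⁻¹)`. [cite: Rogawski1990, §4.9 Prop. 4.9.1 (a) p. 55] -/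
theorem isVertexLattice_diagonal_mapGL_perm_iff (σ : K →+* K) (ϖ : K) {π : Equiv.Perm (Fin N)} (P : GL (Fin N) K)
    (hP : (P : Matrix (Fin N) (Fin N) K) = π.permMatrix K) (D : Fin N → K) (tv : ℕ) (M : Submodule 𝒪[K] (Fin N → K)) :
    IsVertexLattice σ ϖ (Matrix.diagonal D) tv (mapGL P M) ↔ IsVertexLattice σ ϖ (Matrix.diagonal (D ∘ ⇑π.symm)) tv M := by
  rw [← formCongr_permMatrix_diagonal σ P hP D]
  exact (isVertexLattice_formCongr_iff P (Matrix.diagonal D) tv M).symm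

/-- **TYPE-2 POLARISABILITY**: `P·M` is type-2 polarisable iff `M` is (`D ↦ D ∘ π⁻¹`, inverse `D ↦ D ∘ π`). [cite: Rogawski1990, §4.9 Prop. 4.9.1 (a) p. 55] -/
theorem isTypeTwoPolarisable_mapGL_perm_iff (σ : K →+* K) (ϖ : K) {π : Equiv.Perm (Fin N)} (P : GL (Fin N) K)
    (hP : (P : Matrix (Fin N) (Fin N) K) = π.permMatrix K) (M : Submodule 𝒪[K] (Fin N → K)) :
    IsTypeTwoPolarisable σ ϖ (mapGL P M) ↔ IsTypeTwoPolarisable σ ϖ M := by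
  rw [isTypeTwoPolarisable_iff, isTypeTwoPolarisable_iff]
  constructor
  · rintro ⟨D, hD, hV⟩
    exact ⟨D ∘ ⇑π.symm, fun i => hD (π.symm i), (isVertexLattice_diagonal_mapGL_perm_iff σ ϖ P hP D 2 M).1 hV⟩
  · rintro ⟨D, hD, hV⟩
    refine ⟨D ∘ ⇑π, fun i => hD (π i), (isVertexLattice_diagonal_mapGL_perm_iff σ ϖ P hP (D ∘ ⇑π) 2 M).2 ?_⟩
    have e : (D ∘ ⇑π) ∘ ⇑π.symm = D := by rw [Function.comp_assoc, Equiv.self_comp_symm, Function.comp_id]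
    rwa [e]

/-- **THE `σ`-FIXED DIAGONAL STABILISER**: `u ∈ S_F(P·M) ↔ u ∘ π⁻¹ ∈ S_F(M)` (★ `mem_latticeStabilizer_mapGL_perm_iff`; `𝒰` is permutation-stable). [cite: Kottwitz1986BaseChangeUnits, §1 pp. 240–241] -/
theorem mem_fixedUnitStabilizer_mapGL_perm_iff (σ : K →+* K) {π : Equiv.Perm (Fin N)} (P : GL (Fin N) K) (hP : (P : Matrix (Fin N) (Fin N) K) = π.permMatrix K)
    (M : Submodule 𝒪[K] (Fin N → K)) (u : Fin N → Kˣ) :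
    u ∈ fixedUnitStabilizer σ (mapGL P M) ↔ (fun i => u (π.symm i)) ∈ fixedUnitStabilizer σ M := by
  rw [fixedUnitStabilizer, fixedUnitStabilizer, Subgroup.mem_inf, Subgroup.mem_inf, mem_latticeStabilizer_mapGL_perm_iff P hP M u,
    mem_fixedUnitTorus_iff, mem_fixedUnitTorus_iff]
  constructor
  · rintro ⟨h1, h2, h3⟩; exact ⟨h1, fun i => h2 (π.symm i), fun i => h3 (π.symm i)⟩
  · rintro ⟨h1, h2, h3⟩
    refine ⟨h1, fun i => ?_, fun i => ?_⟩
    · have := h2 (π i); rwa [Equiv.symm_apply_apply] at this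
    · have := h3 (π i); rwa [Equiv.symm_apply_apply] at this

/-! ## §2  The type-2 stratum is the permuted image of the permuted type-2 stratum; general-weight transport -/

/-- **`P · stratumTwo(P⁻¹TP, a ∘ π⁻¹) = stratumTwo(T, a)`.** [cite: Kottwitz1986BaseChangeUnits, §1 pp. 240–241] -/
theorem image_mapGL_stratumTwo (σ : K →+* K) (ϖ : K) {π : Equiv.Perm (Fin N)} (P : GL (Fin N) K) (hP : (P : Matrix (Fin N) (Fin N) K) = π.permMatrix K)
    (T : GL (Fin N) K) (a : Fin N → ℕ) :
    mapGL P '' stratumTwo σ ϖ (P⁻¹ * T * P) (a ∘ ⇑π.symm) = stratumTwo σ ϖ T a := by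
  ext M'
  constructor
  · rintro ⟨M, hM, rfl⟩
    rw [mem_stratumTwo_iff] at hM ⊢
    exact ⟨(mapGL_perm_mem_normalisedStableLattices_iff P hP T M).2 hM.1, (isTypeTwoPolarisable_mapGL_perm_iff σ ϖ P hP M).2 hM.2.1,
      (hasAxis_mapGL_perm_iff P hP ϖ M a).2 hM.2.2⟩
  · intro hM'
    refine ⟨mapGL P⁻¹ M', ?_, mapGL_mapGL_inv P M'⟩
    rw [mem_stratumTwo_iff] at hM' ⊢
    have h := hM'
    rw [← mapGL_mapGL_inv P M'] at h
    exact ⟨(mapGL_perm_mem_normalisedStableLattices_iff P hP T _).1 h.1, (isTypeTwoPolarisable_mapGL_perm_iff σ ϖ P hP _).1 h.2.1,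
      (hasAxis_mapGL_perm_iff P hP ϖ _ a).1 h.2.2⟩

/-- **§P₂ HEAD — A PERMUTATION-INVARIANT WEIGHT HAS THE SAME SUM OVER `stratumTwo(T, a)` AND OVER `stratumTwo(P⁻¹TP, a ∘ π⁻¹)`** (`f` arbitrary with `f (P·M) = f M`;
for `T = diag(d)`, `P⁻¹TP = diag(d ∘ π⁻¹)` by ★ `coe_conj_eq_diagonal`). [cite: Kottwitz1986BaseChangeUnits, §1 pp. 240–241] [cite: Rogawski1990, §4.9 Prop. 4.9.1 (a) p. 55] -/
theorem finsum_mem_stratumTwo_perm (σ : K →+* K) (ϖ : K) {π : Equiv.Perm (Fin N)} (P : GL (Fin N) K)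
    (hP : (P : Matrix (Fin N) (Fin N) K) = π.permMatrix K) (T : GL (Fin N) K) (a : Fin N → ℕ) {R : Type*} [AddCommMonoid R]
    (f : Submodule 𝒪[K] (Fin N → K) → R) (hf : ∀ M, f (mapGL P M) = f M) :
    ∑ᶠ M ∈ stratumTwo σ ϖ T a, f M = ∑ᶠ M ∈ stratumTwo σ ϖ (P⁻¹ * T * P) (a ∘ ⇑π.symm), f M := by
  rw [← image_mapGL_stratumTwo σ ϖ P hP T a, finsum_mem_image (mapGL_injective P).injOn]
  exact finsum_mem_congr rfl fun M _ => hf M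

/-- The `f := stabiliserWeight σ` instance: `∑ᶠ_{M ∈ stratumTwo(T, a)} 1∕[𝒰 : S_F(M)] = ∑ᶠ_{M ∈ stratumTwo(P⁻¹TP, a ∘ π⁻¹)} 1∕[𝒰 : S_F(M)]` (★ `stabiliserWeight_mapGL_perm`).
[cite: Kottwitz1986BaseChangeUnits, §1 pp. 240–241] -/
theorem finsum_stabiliserWeight_stratumTwo_perm (σ : K →+* K) (ϖ : K) {π : Equiv.Perm (Fin N)} (P : GL (Fin N) K)
    (hP : (P : Matrix (Fin N) (Fin N) K) = π.permMatrix K) (T : GL (Fin N) K) (a : Fin N → ℕ) :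
    ∑ᶠ M ∈ stratumTwo σ ϖ T a, stabiliserWeight σ M = ∑ᶠ M ∈ stratumTwo σ ϖ (P⁻¹ * T * P) (a ∘ ⇑π.symm), stabiliserWeight σ M :=
  finsum_mem_stratumTwo_perm σ ϖ P hP T a (stabiliserWeight σ) fun M => stabiliserWeight_mapGL_perm σ P hP M

/-- `stratumTwo(sT, a) = stratumTwo(T, a)` for a unit scalar `s` (★ `normalisedStableLattices_eq_of_coe_eq_smul`). [cite: Kottwitz1986BaseChangeUnits, §1 pp. 240–241] -/
theorem stratumTwo_eq_of_coe_eq_smul (σ : K →+* K) (ϖ : K) {s : K} (hs : Valued.v s = 1) {T T'' : GL (Fin N) K}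
    (hTT : (T'' : Matrix (Fin N) (Fin N) K) = s • (T : Matrix (Fin N) (Fin N) K)) (a : Fin N → ℕ) : stratumTwo σ ϖ T'' a = stratumTwo σ ϖ T a := by
  ext M
  rw [mem_stratumTwo_iff, mem_stratumTwo_iff, normalisedStableLattices_eq_of_coe_eq_smul hs hTT]

/-! ## §3  The B10₂ adapters: foot on `B₂` ∕ `B₃` from foot on `B₁`, for a general axis triple and a general permutation-invariant weight -/

section Sockets

open Literature.NumberTheory.Automorphic.UnitaryThreeFourFrame

variable {K : Type} [Field K] [Valued K ℤᵐ⁰] {σ : K →+* K} {ϖ : K} {α β : K} {N₀ n₁ n₂ n₃ : ℕ} {T : GL (Fin 3) K} {R : Type} [AddCommMonoid R]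

/-- **ADAPTER `(a, b, c) ↦ (b, a, c)`** (at `(2ρ+1, 2ρ+1+s, 2ρ+1+s)`: the type-2 glued stratum with foot on `B₂` from the `B₁`-footed one): for a weight `f` invariant under
coordinate permutations and a `B₁`-footed evaluation `hG1` quantified over the element datum, the coordinate swap `(0 1)` — `diag(α, β, 1) ↦ diag(β, α, 1)`, depths
`(n₁, n₂, n₃) ↦ (n₂, n₁, n₃)` (★ `isElementDatum_swap`). [cite: Kottwitz1986BaseChangeUnits, §1 pp. 240–241] [cite: Rogawski1990, §4.9 Prop. 4.9.1 (a) p. 55] -/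
theorem finsum_mem_stratumTwo_swap01_of (hE : IsElementDatum σ ϖ N₀ α β n₁ n₂ n₃)
    (hT : (T : Matrix (Fin 3) (Fin 3) K) = Matrix.diagonal ![α, β, 1]) (a b c : ℕ) (f : Submodule 𝒪[K] (Fin 3 → K) → R)
    (hf : ∀ (π : Equiv.Perm (Fin 3)) (P : GL (Fin 3) K), (P : Matrix (Fin 3) (Fin 3) K) = π.permMatrix K → ∀ M, f (mapGL P M) = f M) (F : ℕ → ℕ → ℕ → R)
    (hG1 : ∀ {α' β' : K} {n₁' n₂' n₃' : ℕ} (T' : GL (Fin 3) K), IsElementDatum σ ϖ N₀ α' β' n₁' n₂' n₃' →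
      (T' : Matrix (Fin 3) (Fin 3) K) = Matrix.diagonal ![α', β', 1] → ∑ᶠ M ∈ stratumTwo σ ϖ T' ![a, b, c], f M = F n₁' n₂' n₃') :
    ∑ᶠ M ∈ stratumTwo σ ϖ T ![b, a, c], f M = F n₂ n₁ n₃ := by
  obtain ⟨P, hP⟩ := exists_gl_coe_eq_permMatrix (K := K) (Equiv.swap (0 : Fin 3) 1)
  rw [finsum_mem_stratumTwo_perm σ ϖ P hP T _ f (hf _ P hP)]
  have ha : (![b, a, c] : Fin 3 → ℕ) ∘ ⇑(Equiv.swap (0 : Fin 3) 1).symm = ![a, b, c] := by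
    ext i; fin_cases i <;> rfl
  have hd : (![α, β, 1] : Fin 3 → K) ∘ ⇑(Equiv.swap (0 : Fin 3) 1).symm = ![β, α, 1] := by
    ext i; fin_cases i <;> rfl
  rw [ha]
  exact hG1 _ (isElementDatum_swap hE) (by rw [coe_conj_eq_diagonal P hP T hT, hd])

/-- **ADAPTER `(a, b, c) ↦ (c, b, a)`** (at `(2ρ+1, 2ρ+1+s, 2ρ+1+s)`: foot on `B₃` from foot on `B₁`): the coordinate swap `(0 2)` and the unit rescaling by `α⁻¹` —
`diag(α, β, 1) ↦ diag(1, β, α) ∼ diag(α⁻¹, βα⁻¹, 1)`, depths `(n₁, n₂, n₃) ↦ (n₃, n₂, n₁)` (★ `isElementDatum_rescale`, `stratumTwo_eq_of_coe_eq_smul`).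
[cite: Kottwitz1986BaseChangeUnits, §1 pp. 240–241] [cite: Rogawski1990, §4.9 Prop. 4.9.1 (a) p. 55] -/
theorem finsum_mem_stratumTwo_swap02_of (hvσ : ∀ x, Valued.v (σ x) = Valued.v x) (hE : IsElementDatum σ ϖ N₀ α β n₁ n₂ n₃)
    (hT : (T : Matrix (Fin 3) (Fin 3) K) = Matrix.diagonal ![α, β, 1]) (a b c : ℕ) (f : Submodule 𝒪[K] (Fin 3 → K) → R)
    (hf : ∀ (π : Equiv.Perm (Fin 3)) (P : GL (Fin 3) K), (P : Matrix (Fin 3) (Fin 3) K) = π.permMatrix K → ∀ M, f (mapGL P M) = f M) (F : ℕ → ℕ → ℕ → R)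
    (hG1 : ∀ {α' β' : K} {n₁' n₂' n₃' : ℕ} (T' : GL (Fin 3) K), IsElementDatum σ ϖ N₀ α' β' n₁' n₂' n₃' →
      (T' : Matrix (Fin 3) (Fin 3) K) = Matrix.diagonal ![α', β', 1] → ∑ᶠ M ∈ stratumTwo σ ϖ T' ![a, b, c], f M = F n₁' n₂' n₃') :
    ∑ᶠ M ∈ stratumTwo σ ϖ T ![c, b, a], f M = F n₃ n₂ n₁ := by
  have hα : α * σ α = 1 := hE.1
  have hα0 : α ≠ 0 := fun h => by rw [h, zero_mul] at hα; exact zero_ne_one hα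
  have hvα : Valued.v α = 1 := by
    have h : Valued.v α * Valued.v α = 1 := by nth_rw 2 [← hvσ α]; rw [← map_mul, hα, map_one]
    rw [← pow_two] at h
    exact ((pow_eq_one_iff).1 h).resolve_right two_ne_zero
  obtain ⟨P, hP⟩ := exists_gl_coe_eq_permMatrix (K := K) (Equiv.swap (0 : Fin 3) 2)
  rw [finsum_mem_stratumTwo_perm σ ϖ P hP T _ f (hf _ P hP)]
  have ha : (![c, b, a] : Fin 3 → ℕ) ∘ ⇑(Equiv.swap (0 : Fin 3) 2).symm = ![a, b, c] := by
    ext i; fin_cases i <;> rfl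
  have hd : (![α, β, 1] : Fin 3 → K) ∘ ⇑(Equiv.swap (0 : Fin 3) 2).symm = ![1, β, α] := by
    ext i; fin_cases i <;> rfl
  rw [ha]
  -- rescale `diag(1, β, α)` by the unit `α⁻¹`
  have hdet : (Matrix.diagonal ![α⁻¹, β * α⁻¹, 1] : Matrix (Fin 3) (Fin 3) K).det ≠ 0 := by
    rw [Matrix.det_diagonal, Fin.prod_univ_three]
    have hβ0 : β ≠ 0 := fun h => by have := hE.2.1; rw [h, zero_mul] at this; exact zero_ne_one this
    simp [hα0, hβ0]
  have hconj := coe_conj_eq_diagonal P hP T hT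
  rw [hd] at hconj
  have hTT : ((Matrix.GeneralLinearGroup.mkOfDetNeZero _ hdet : GL (Fin 3) K) : Matrix (Fin 3) (Fin 3) K) =
      α⁻¹ • ((P⁻¹ * T * P : GL (Fin 3) K) : Matrix (Fin 3) (Fin 3) K) := by
    rw [hconj, ← Matrix.diagonal_smul]
    show Matrix.diagonal ![α⁻¹, β * α⁻¹, 1] = _
    congr 1
    ext i; fin_cases i
    · simp
    · simp [mul_comm]
    · simp [inv_mul_cancel₀ hα0]
  rw [← stratumTwo_eq_of_coe_eq_smul σ ϖ (by rw [map_inv₀, hvα, inv_one]) hTT]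
  exact hG1 _ (isElementDatum_rescale hvσ hE) rfl

/-! ### The `f := stabiliserWeight σ` instances (names and binders = LH4-p11 (g2)'s cand `F0P3cDyRamDiagonalPermutationTwo.cand.v1.LH4p11g2` df7f82c7, merged here by letter) -/

/-- **SWAP `(0 1)`, ANY AXIS TRIPLE, weight `w`**: `stratumTwo(T, (a₁, a₀, a₂))` weighs `F n₂ n₁ n₃` if `stratumTwo(T', (a₀, a₁, a₂))` weighs `F n₁' n₂' n₃'` at every datum.
[cite: Kottwitz1986BaseChangeUnits, §1 pp. 240–241] [cite: Rogawski1990, §4.9 Prop. 4.9.1 (a) p. 55] -/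
theorem finsum_stabiliserWeight_stratumTwo_swap01_of (hE : IsElementDatum σ ϖ N₀ α β n₁ n₂ n₃)
    (hT : (T : Matrix (Fin 3) (Fin 3) K) = Matrix.diagonal ![α, β, 1]) (a₀ a₁ a₂ : ℕ) (F : ℕ → ℕ → ℕ → ℚ)
    (h : ∀ {α' β' : K} {n₁' n₂' n₃' : ℕ} (T' : GL (Fin 3) K), IsElementDatum σ ϖ N₀ α' β' n₁' n₂' n₃' →
      (T' : Matrix (Fin 3) (Fin 3) K) = Matrix.diagonal ![α', β', 1] →
        ∑ᶠ M ∈ stratumTwo σ ϖ T' ![a₀, a₁, a₂], stabiliserWeight σ M = F n₁' n₂' n₃') :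
    ∑ᶠ M ∈ stratumTwo σ ϖ T ![a₁, a₀, a₂], stabiliserWeight σ M = F n₂ n₁ n₃ :=
  finsum_mem_stratumTwo_swap01_of hE hT a₀ a₁ a₂ (stabiliserWeight σ) (fun _ P hP M => stabiliserWeight_mapGL_perm σ P hP M) F h

/-- **SWAP `(0 2)` + UNIT RESCALING, ANY AXIS TRIPLE, weight `w`**: `stratumTwo(T, (a₂, a₁, a₀))` weighs `F n₃ n₂ n₁`.
[cite: Kottwitz1986BaseChangeUnits, §1 pp. 240–241] [cite: Rogawski1990, §4.9 Prop. 4.9.1 (a) p. 55] -/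
theorem finsum_stabiliserWeight_stratumTwo_swap02_of (hvσ : ∀ a, Valued.v (σ a) = Valued.v a) (hE : IsElementDatum σ ϖ N₀ α β n₁ n₂ n₃)
    (hT : (T : Matrix (Fin 3) (Fin 3) K) = Matrix.diagonal ![α, β, 1]) (a₀ a₁ a₂ : ℕ) (F : ℕ → ℕ → ℕ → ℚ)
    (h : ∀ {α' β' : K} {n₁' n₂' n₃' : ℕ} (T' : GL (Fin 3) K), IsElementDatum σ ϖ N₀ α' β' n₁' n₂' n₃' →
      (T' : Matrix (Fin 3) (Fin 3) K) = Matrix.diagonal ![α', β', 1] →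
        ∑ᶠ M ∈ stratumTwo σ ϖ T' ![a₀, a₁, a₂], stabiliserWeight σ M = F n₁' n₂' n₃') :
    ∑ᶠ M ∈ stratumTwo σ ϖ T ![a₂, a₁, a₀], stabiliserWeight σ M = F n₃ n₂ n₁ :=
  finsum_mem_stratumTwo_swap02_of hvσ hE hT a₀ a₁ a₂ (stabiliserWeight σ) (fun _ P hP M => stabiliserWeight_mapGL_perm σ P hP M) F h

/-- **SOCKET `stub_P_T2` (type 2) — ON-BRANCH, FOOT `(s, 0, s)`** from the `(0, s, s)` count at every datum: value `F n₂ n₁ n₃` (an alternative to the direct ★-to-be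
`finsum_stabiliserWeight_stratumTwo_T2`). [cite: Kottwitz1986BaseChangeUnits, §1 pp. 240–241] -/
theorem finsum_stabiliserWeight_stratumTwo_T2_of_T1 (hE : IsElementDatum σ ϖ N₀ α β n₁ n₂ n₃)
    (hT : (T : Matrix (Fin 3) (Fin 3) K) = Matrix.diagonal ![α, β, 1]) (s : ℕ) (F : ℕ → ℕ → ℕ → ℚ)
    (hT1 : ∀ {α' β' : K} {n₁' n₂' n₃' : ℕ} (T' : GL (Fin 3) K), IsElementDatum σ ϖ N₀ α' β' n₁' n₂' n₃' →
      (T' : Matrix (Fin 3) (Fin 3) K) = Matrix.diagonal ![α', β', 1] →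
        ∑ᶠ M ∈ stratumTwo σ ϖ T' ![0, s, s], stabiliserWeight σ M = F n₁' n₂' n₃') :
    ∑ᶠ M ∈ stratumTwo σ ϖ T ![s, 0, s], stabiliserWeight σ M = F n₂ n₁ n₃ :=
  finsum_stabiliserWeight_stratumTwo_swap01_of hE hT 0 s s F hT1

/-- **SOCKET `stub_P_T3` (type 2) — ON-BRANCH, FOOT `(s, s, 0)`** from the `(0, s, s)` count at every datum: value `F n₃ n₂ n₁`. [cite: Kottwitz1986BaseChangeUnits, §1 pp. 240–241] -/
theorem finsum_stabiliserWeight_stratumTwo_T3_of_T1 (hvσ : ∀ a, Valued.v (σ a) = Valued.v a) (hE : IsElementDatum σ ϖ N₀ α β n₁ n₂ n₃)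
    (hT : (T : Matrix (Fin 3) (Fin 3) K) = Matrix.diagonal ![α, β, 1]) (s : ℕ) (F : ℕ → ℕ → ℕ → ℚ)
    (hT1 : ∀ {α' β' : K} {n₁' n₂' n₃' : ℕ} (T' : GL (Fin 3) K), IsElementDatum σ ϖ N₀ α' β' n₁' n₂' n₃' →
      (T' : Matrix (Fin 3) (Fin 3) K) = Matrix.diagonal ![α', β', 1] →
        ∑ᶠ M ∈ stratumTwo σ ϖ T' ![0, s, s], stabiliserWeight σ M = F n₁' n₂' n₃') :
    ∑ᶠ M ∈ stratumTwo σ ϖ T ![s, s, 0], stabiliserWeight σ M = F n₃ n₂ n₁ :=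
  finsum_stabiliserWeight_stratumTwo_swap02_of hvσ hE hT 0 s s F hT1

/-- **SOCKET `stub_P_G2` (type 2) — GLUED, FOOT ON `B₂`, axis `(r+s, r, r+s)`** from the `B₁`-footed count `(r, r+s, r+s)` at every datum (`r = 2ρ+1` for the type-2 glued
strata; ★-to-be `stub_B56_G1`₂): value `F n₂ n₁ n₃`. [cite: Kottwitz1986BaseChangeUnits, §1 pp. 240–241] [cite: Rogawski1990, §4.9 Prop. 4.9.1 (a) p. 55] -/
theorem finsum_stabiliserWeight_stratumTwo_G2_of_G1 (hE : IsElementDatum σ ϖ N₀ α β n₁ n₂ n₃)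
    (hT : (T : Matrix (Fin 3) (Fin 3) K) = Matrix.diagonal ![α, β, 1]) (r s : ℕ) (F : ℕ → ℕ → ℕ → ℚ)
    (hG1 : ∀ {α' β' : K} {n₁' n₂' n₃' : ℕ} (T' : GL (Fin 3) K), IsElementDatum σ ϖ N₀ α' β' n₁' n₂' n₃' →
      (T' : Matrix (Fin 3) (Fin 3) K) = Matrix.diagonal ![α', β', 1] →
        ∑ᶠ M ∈ stratumTwo σ ϖ T' ![r, r + s, r + s], stabiliserWeight σ M = F n₁' n₂' n₃') :
    ∑ᶠ M ∈ stratumTwo σ ϖ T ![r + s, r, r + s], stabiliserWeight σ M = F n₂ n₁ n₃ :=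
  finsum_stabiliserWeight_stratumTwo_swap01_of hE hT r (r + s) (r + s) F hG1

/-- **SOCKET `stub_P_G3` (type 2) — GLUED, FOOT ON `B₃`, axis `(r+s, r+s, r)`** from the `B₁`-footed count at every datum: value `F n₃ n₂ n₁`.
[cite: Kottwitz1986BaseChangeUnits, §1 pp. 240–241] [cite: Rogawski1990, §4.9 Prop. 4.9.1 (a) p. 55] -/
theorem finsum_stabiliserWeight_stratumTwo_G3_of_G1 (hvσ : ∀ a, Valued.v (σ a) = Valued.v a) (hE : IsElementDatum σ ϖ N₀ α β n₁ n₂ n₃)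
    (hT : (T : Matrix (Fin 3) (Fin 3) K) = Matrix.diagonal ![α, β, 1]) (r s : ℕ) (F : ℕ → ℕ → ℕ → ℚ)
    (hG1 : ∀ {α' β' : K} {n₁' n₂' n₃' : ℕ} (T' : GL (Fin 3) K), IsElementDatum σ ϖ N₀ α' β' n₁' n₂' n₃' →
      (T' : Matrix (Fin 3) (Fin 3) K) = Matrix.diagonal ![α', β', 1] →
        ∑ᶠ M ∈ stratumTwo σ ϖ T' ![r, r + s, r + s], stabiliserWeight σ M = F n₁' n₂' n₃') :
    ∑ᶠ M ∈ stratumTwo σ ϖ T ![r + s, r + s, r], stabiliserWeight σ M = F n₃ n₂ n₁ :=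
  finsum_stabiliserWeight_stratumTwo_swap02_of hvσ hE hT r (r + s) (r + s) F hG1

end Sockets

/-! ## §4  ED. 2 (append-only, after ★ StrataDefs ED. 3 `polarisationCount`): the re-keyed multiplicity is permutation-invariant, and the `n₂·w` instances -/

section PolarisationCount

variable {K : Type*} [Field K] [Valued K ℤᵐ⁰] {N : ℕ}

/-- **THE POLARISATION COSETS OF `P·M` ARE THE RE-INDEXED COSETS OF `M`**: `C ↦ {D ∘ π⁻¹ | D ∈ C}` maps `Δ_tv(P·M)∕S_F(P·M)` onto `Δ_tv(M)∕S_F(M)`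
(§1: polarisations correspond under `D ↦ D ∘ π⁻¹`, and so do the stabilisers). [cite: Kottwitz1986BaseChangeUnits, §1 pp. 240–241] [cite: Rogawski1990, §4.9 Prop. 4.9.1 (a) p. 55] -/
theorem image_polarisationCosets_mapGL_perm (σ : K →+* K) (ϖ : K) {π : Equiv.Perm (Fin N)} (P : GL (Fin N) K)
    (hP : (P : Matrix (Fin N) (Fin N) K) = π.permMatrix K) (tv : ℕ) (M : Submodule 𝒪[K] (Fin N → K)) :
    (fun C : Set (Fin N → K) => (fun D : Fin N → K => D ∘ ⇑π.symm) '' C) '' polarisationCosets σ ϖ tv (mapGL P M) = polarisationCosets σ ϖ tv M := by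
  -- the coset of `D` for `P·M` is carried to the coset of `D ∘ π⁻¹` for `M`
  have hcoset : ∀ D : Fin N → K, (fun D' : Fin N → K => D' ∘ ⇑π.symm) ''
      {D' : Fin N → K | ∃ u ∈ fixedUnitStabilizer σ (mapGL P M), ∀ i, D' i = D i * ((u i : Kˣ) : K)} =
      {D' : Fin N → K | ∃ u ∈ fixedUnitStabilizer σ M, ∀ i, D' i = (D ∘ ⇑π.symm) i * ((u i : Kˣ) : K)} := by
    intro D
    ext E
    constructor
    · rintro ⟨D', ⟨u, hu, hD'⟩, rfl⟩
      exact ⟨fun i => u (π.symm i), (mem_fixedUnitStabilizer_mapGL_perm_iff σ P hP M u).1 hu, fun i => hD' (π.symm i)⟩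
    · rintro ⟨v, hv, hE⟩
      refine ⟨fun i => D i * ((v (π i) : Kˣ) : K), ⟨fun i => v (π i), (mem_fixedUnitStabilizer_mapGL_perm_iff σ P hP M _).2 ?_, fun i => rfl⟩, ?_⟩
      · have e : (fun i => (fun i => v (π i)) (π.symm i)) = v := funext fun i => by simp
        rw [e]; exact hv
      · funext i
        simp only [Function.comp_apply, Equiv.apply_symm_apply]
        exact (hE i).symm
  ext C
  simp only [Set.mem_image, mem_polarisationCosets_iff]
  constructor
  · rintro ⟨C', ⟨D, ⟨hD, hV⟩, rfl⟩, rfl⟩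
    exact ⟨D ∘ ⇑π.symm, ⟨fun i => hD (π.symm i), (isVertexLattice_diagonal_mapGL_perm_iff σ ϖ P hP D tv M).1 hV⟩, hcoset D⟩
  · rintro ⟨D, ⟨hD, hV⟩, rfl⟩
    have e : (D ∘ ⇑π) ∘ ⇑π.symm = D := by rw [Function.comp_assoc, Equiv.self_comp_symm, Function.comp_id]
    refine ⟨{D' : Fin N → K | ∃ u ∈ fixedUnitStabilizer σ (mapGL P M), ∀ i, D' i = (D ∘ ⇑π) i * ((u i : Kˣ) : K)},
      ⟨D ∘ ⇑π, ⟨fun i => hD (π i), (isVertexLattice_diagonal_mapGL_perm_iff σ ϖ P hP (D ∘ ⇑π) tv M).2 (by rw [e]; exact hV)⟩, rfl⟩, ?_⟩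
    rw [hcoset (D ∘ ⇑π), e]

/-- **`polarisationCount` IS PERMUTATION-INVARIANT**: `n_tv(P·M) = n_tv(M)` (the re-indexing of cosets is injective on sets). [cite: Kottwitz1986BaseChangeUnits, §1 pp. 240–241] -/
theorem polarisationCount_mapGL_perm (σ : K →+* K) (ϖ : K) {π : Equiv.Perm (Fin N)} (P : GL (Fin N) K)
    (hP : (P : Matrix (Fin N) (Fin N) K) = π.permMatrix K) (tv : ℕ) (M : Submodule 𝒪[K] (Fin N → K)) :
    polarisationCount σ ϖ tv (mapGL P M) = polarisationCount σ ϖ tv M := by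
  have hinj : Function.Injective (fun D : Fin N → K => D ∘ ⇑π.symm) := fun D₁ D₂ h => by
    have h' := congrArg (fun E : Fin N → K => E ∘ ⇑π) h
    simpa only [Function.comp_assoc, Equiv.symm_comp_self, Function.comp_id] using h'
  rw [polarisationCount_eq, polarisationCount_eq, ← image_polarisationCosets_mapGL_perm σ ϖ P hP tv M,
    Set.ncard_image_of_injective _ (Set.image_injective.2 hinj)]

/-- The `f := n₂·w` instance of the §P₂ head: **the re-keyed weighted count of a type-2 stratum is invariant under a coordinate permutation.**
[cite: Kottwitz1986BaseChangeUnits, §1 pp. 240–241] [cite: Rogawski1990, §4.9 Prop. 4.9.1 (a) p. 55] -/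
theorem finsum_polarisationCount_mul_stabiliserWeight_stratumTwo_perm (σ : K →+* K) (ϖ : K) {π : Equiv.Perm (Fin N)} (P : GL (Fin N) K)
    (hP : (P : Matrix (Fin N) (Fin N) K) = π.permMatrix K) (T : GL (Fin N) K) (a : Fin N → ℕ) :
    ∑ᶠ M ∈ stratumTwo σ ϖ T a, (polarisationCount σ ϖ 2 M : ℚ) * stabiliserWeight σ M =
      ∑ᶠ M ∈ stratumTwo σ ϖ (P⁻¹ * T * P) (a ∘ ⇑π.symm), (polarisationCount σ ϖ 2 M : ℚ) * stabiliserWeight σ M :=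
  finsum_mem_stratumTwo_perm σ ϖ P hP T a _ fun M => by rw [polarisationCount_mapGL_perm σ ϖ P hP, stabiliserWeight_mapGL_perm σ P hP]

end PolarisationCount

section SocketsMult

open Literature.NumberTheory.Automorphic.UnitaryThreeFourFrame

variable {K : Type} [Field K] [Valued K ℤᵐ⁰] {σ : K →+* K} {ϖ : K} {α β : K} {N₀ n₁ n₂ n₃ : ℕ} {T : GL (Fin 3) K}

/-- **RE-KEYED SWAP `(0 1)`, ANY AXIS TRIPLE, weight `n₂·w`.** [cite: Kottwitz1986BaseChangeUnits, §1 pp. 240–241] [cite: Rogawski1990, §4.9 Prop. 4.9.1 (a) p. 55] -/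
theorem finsum_polarisationCount_mul_stabiliserWeight_stratumTwo_swap01_of (hE : IsElementDatum σ ϖ N₀ α β n₁ n₂ n₃)
    (hT : (T : Matrix (Fin 3) (Fin 3) K) = Matrix.diagonal ![α, β, 1]) (a₀ a₁ a₂ : ℕ) (F : ℕ → ℕ → ℕ → ℚ)
    (h : ∀ {α' β' : K} {n₁' n₂' n₃' : ℕ} (T' : GL (Fin 3) K), IsElementDatum σ ϖ N₀ α' β' n₁' n₂' n₃' →
      (T' : Matrix (Fin 3) (Fin 3) K) = Matrix.diagonal ![α', β', 1] →
        ∑ᶠ M ∈ stratumTwo σ ϖ T' ![a₀, a₁, a₂], (polarisationCount σ ϖ 2 M : ℚ) * stabiliserWeight σ M = F n₁' n₂' n₃') :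
    ∑ᶠ M ∈ stratumTwo σ ϖ T ![a₁, a₀, a₂], (polarisationCount σ ϖ 2 M : ℚ) * stabiliserWeight σ M = F n₂ n₁ n₃ :=
  finsum_mem_stratumTwo_swap01_of hE hT a₀ a₁ a₂ _
    (fun _ P hP M => by rw [polarisationCount_mapGL_perm σ ϖ P hP, stabiliserWeight_mapGL_perm σ P hP]) F h

/-- **RE-KEYED SWAP `(0 2)` + UNIT RESCALING, ANY AXIS TRIPLE, weight `n₂·w`.** [cite: Kottwitz1986BaseChangeUnits, §1 pp. 240–241] [cite: Rogawski1990, §4.9 Prop. 4.9.1 (a) p. 55] -/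
theorem finsum_polarisationCount_mul_stabiliserWeight_stratumTwo_swap02_of (hvσ : ∀ a, Valued.v (σ a) = Valued.v a)
    (hE : IsElementDatum σ ϖ N₀ α β n₁ n₂ n₃) (hT : (T : Matrix (Fin 3) (Fin 3) K) = Matrix.diagonal ![α, β, 1]) (a₀ a₁ a₂ : ℕ) (F : ℕ → ℕ → ℕ → ℚ)
    (h : ∀ {α' β' : K} {n₁' n₂' n₃' : ℕ} (T' : GL (Fin 3) K), IsElementDatum σ ϖ N₀ α' β' n₁' n₂' n₃' →
      (T' : Matrix (Fin 3) (Fin 3) K) = Matrix.diagonal ![α', β', 1] →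
        ∑ᶠ M ∈ stratumTwo σ ϖ T' ![a₀, a₁, a₂], (polarisationCount σ ϖ 2 M : ℚ) * stabiliserWeight σ M = F n₁' n₂' n₃') :
    ∑ᶠ M ∈ stratumTwo σ ϖ T ![a₂, a₁, a₀], (polarisationCount σ ϖ 2 M : ℚ) * stabiliserWeight σ M = F n₃ n₂ n₁ :=
  finsum_mem_stratumTwo_swap02_of hvσ hE hT a₀ a₁ a₂ _
    (fun _ P hP M => by rw [polarisationCount_mapGL_perm σ ϖ P hP, stabiliserWeight_mapGL_perm σ P hP]) F h

/-- **RE-KEYED SOCKET `stub_P_G2`₂ — foot on `B₂`, axis `(r+s, r, r+s)` from `(r, r+s, r+s)`, weight `n₂·w`.** [cite: Kottwitz1986BaseChangeUnits, §1 pp. 240–241] -/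
theorem finsum_polarisationCount_mul_stabiliserWeight_stratumTwo_G2_of_G1 (hE : IsElementDatum σ ϖ N₀ α β n₁ n₂ n₃)
    (hT : (T : Matrix (Fin 3) (Fin 3) K) = Matrix.diagonal ![α, β, 1]) (r s : ℕ) (F : ℕ → ℕ → ℕ → ℚ)
    (hG1 : ∀ {α' β' : K} {n₁' n₂' n₃' : ℕ} (T' : GL (Fin 3) K), IsElementDatum σ ϖ N₀ α' β' n₁' n₂' n₃' →
      (T' : Matrix (Fin 3) (Fin 3) K) = Matrix.diagonal ![α', β', 1] →
        ∑ᶠ M ∈ stratumTwo σ ϖ T' ![r, r + s, r + s], (polarisationCount σ ϖ 2 M : ℚ) * stabiliserWeight σ M = F n₁' n₂' n₃') :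
    ∑ᶠ M ∈ stratumTwo σ ϖ T ![r + s, r, r + s], (polarisationCount σ ϖ 2 M : ℚ) * stabiliserWeight σ M = F n₂ n₁ n₃ :=
  finsum_polarisationCount_mul_stabiliserWeight_stratumTwo_swap01_of hE hT r (r + s) (r + s) F hG1

/-- **RE-KEYED SOCKET `stub_P_G3`₂ — foot on `B₃`, axis `(r+s, r+s, r)` from `(r, r+s, r+s)`, weight `n₂·w`.** [cite: Kottwitz1986BaseChangeUnits, §1 pp. 240–241] -/
theorem finsum_polarisationCount_mul_stabiliserWeight_stratumTwo_G3_of_G1 (hvσ : ∀ a, Valued.v (σ a) = Valued.v a)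
    (hE : IsElementDatum σ ϖ N₀ α β n₁ n₂ n₃) (hT : (T : Matrix (Fin 3) (Fin 3) K) = Matrix.diagonal ![α, β, 1]) (r s : ℕ) (F : ℕ → ℕ → ℕ → ℚ)
    (hG1 : ∀ {α' β' : K} {n₁' n₂' n₃' : ℕ} (T' : GL (Fin 3) K), IsElementDatum σ ϖ N₀ α' β' n₁' n₂' n₃' →
      (T' : Matrix (Fin 3) (Fin 3) K) = Matrix.diagonal ![α', β', 1] →
        ∑ᶠ M ∈ stratumTwo σ ϖ T' ![r, r + s, r + s], (polarisationCount σ ϖ 2 M : ℚ) * stabiliserWeight σ M = F n₁' n₂' n₃') :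
    ∑ᶠ M ∈ stratumTwo σ ϖ T ![r + s, r + s, r], (polarisationCount σ ϖ 2 M : ℚ) * stabiliserWeight σ M = F n₃ n₂ n₁ :=
  finsum_polarisationCount_mul_stabiliserWeight_stratumTwo_swap02_of hvσ hE hT r (r + s) (r + s) F hG1

end SocketsMult

end Summit.HodgeConjecture.HodgeConjecture.Cruxes.H413.F0P3cDyRamDiagonalPermutationTwo

end
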